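import Mathlib
import Summits.NavierStokesRegularity.NavierStokesRegularity.Theorems.SubOnsagerCeilingGapKernel
import HarnessLib

/-!
# The PARAMETRIC Ω-coupled four-window face family (ten faces of the d45 topology with arbitrary rational coefficients)
(helper file for crux stmt-NavierStokesRegularity-27057 `SubOnsagerCeiling.ForwardTailCeilingKP`, `--supports … --as helper`;
LEAD SOC g11, line «kp-shell-barrier»)

RUNG 10 (`SubOnsagerCeilingGapChain`) certified ONE design («d45», `SubOnsagerCeilingGapFaces`) on `b ∈ [3/2, 25/16]`; the exact mirror shows
every such design is valid on a window of `b` of width `≈ 0.15` only (d45: `[1.49, 1.65]`), so the descent towards `b = 5/4` needs a SEQUENCE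
of designs. This file makes a design a DATUM: `Params` = the 28 rational coefficients of the topology «three caps `x_i ≤ 49/50`, three
cubic floors `x_(i+1) ≥ κ x_i³ − ε`, corner caps `a0 x₀ + a1 x₁ + a2 x₂ ≤ ac` and `x₀ + b1 x₁ ≤ bc`, bulk and carve quadric floors
`x₃ ≥ F(x₀,x₁,x₂)`»; `face θ k`, `faceGrad θ k i` with continuity and the chain rule (`face_continuous`, `face_hasDerivWithinAt`);
`face_eq`/`faceGrad_eq`; the region facts under the decidable side conditions `Params.Adm θ` (`face_init`: `[0,1/10]⁴ ⊂ Ω`; `face_safe`;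
`face_damping_easy`). The kernel vocabulary and the certificate bridge are the companion `SubOnsagerCeilingGapFamilyKernel`. A new rung
below `b = 3/2` is then: a `Params` literal + `Adm` by `decide`/`norm_num` + kernel certificates + one slice file — no bespoke Lean.
HONEST FRAMING: MODEL-lattice plumbing (route SubOnsagerCeiling, TL-M2Break); nothing here bears on Navier–Stokes regularity; 27057 OPEN.
[cite: BarbatoMorandinRomito2011, §2 Lemma 2.1 (faces of an invariant region)]
-/

noncomputable section

-- the sub-problem namespace `NavierStokesRegularity.NavierStokesRegularity` is the tree's layout (D-0017)
set_option linter.dupNamespace false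

namespace Summit.NavierStokesRegularity.NavierStokesRegularity.Theorems.VirtualFloor.GapFamily

open Literature.Analysis.ValidatedNumerics
open Summit.NavierStokesRegularity.NavierStokesRegularity.Theorems.VirtualFloor
open Summit.NavierStokesRegularity.NavierStokesRegularity.Theorems.VirtualFloor.GapRung (Ix pt)

/-! ## Designs as data -/

/-- A design of the d45 topology: cubic floors `κ, ε`; corner cap A `a0,a1,a2,ac`; corner cap B `b1,bc`; bulk quadric floor
`fc + f0 x₀ + f1 x₁ + f2 x₂ + f00 x₀² + f11 x₁² + f22 x₂² + f01 x₀x₁ + f02 x₀x₂ + f12 x₁x₂`; carve quadric floor `g…` likewise. [folklore] -/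
structure Params where
  /-- coefficient `κ` -/
  kap : ℚ
  /-- coefficient `ε` -/
  eps : ℚ
  /-- coefficient `a0` -/
  a0 : ℚ
  /-- coefficient `a1` -/
  a1 : ℚ
  /-- coefficient `a2` -/
  a2 : ℚ
  /-- coefficient `ac` -/
  ac : ℚ
  /-- coefficient `b1` -/
  b1 : ℚ
  /-- coefficient `bc` -/
  bc : ℚ
  /-- coefficient `fc` -/
  fc : ℚ
  /-- coefficient `f0` -/
  f0 : ℚ
  /-- coefficient `f1` -/
  f1 : ℚ
  /-- coefficient `f2` -/
  f2 : ℚ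
  /-- coefficient `f00` -/
  f00 : ℚ
  /-- coefficient `f11` -/
  f11 : ℚ
  /-- coefficient `f22` -/
  f22 : ℚ
  /-- coefficient `f01` -/
  f01 : ℚ
  /-- coefficient `f02` -/
  f02 : ℚ
  /-- coefficient `f12` -/
  f12 : ℚ
  /-- coefficient `gc` -/
  gc : ℚ
  /-- coefficient `g0` -/
  g0 : ℚ
  /-- coefficient `g1` -/
  g1 : ℚ
  /-- coefficient `g2` -/
  g2 : ℚ
  /-- coefficient `g00` -/
  g00 : ℚ
  /-- coefficient `g11` -/
  g11 : ℚ
  /-- coefficient `g22` -/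
  g22 : ℚ
  /-- coefficient `g01` -/
  g01 : ℚ
  /-- coefficient `g02` -/
  g02 : ℚ
  /-- coefficient `g12` -/
  g12 : ℚ
  deriving DecidableEq

namespace Params
variable (θ : Params)

/-- Positive part. [folklore] -/
def pos (q : ℚ) : ℚ := max q 0

/-- ADMISSIBILITY (decidable on a literal): signs used by the structural damping conditions and by the elimination of the corner cap A,
and sufficient conditions for `[0, 1/10]⁴ ⊂ Ω` (each face bounded above on the box by its positive coefficients). [folklore] -/
structure Adm : Prop where
  kap_nn : 0 ≤ θ.kap
  eps_nn : 0 ≤ θ.eps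
  cub_init : θ.kap / 1000 ≤ θ.eps
  a0_pos : 0 < θ.a0
  a1_nn : 0 ≤ θ.a1
  a2_nn : 0 ≤ θ.a2
  capA_init : (θ.a0 + θ.a1 + θ.a2) / 10 ≤ θ.ac
  b1_nn : 0 ≤ θ.b1
  capB_init : (1 + θ.b1) / 10 ≤ θ.bc
  bulk_init : θ.fc + (pos θ.f0 + pos θ.f1 + pos θ.f2) / 10 +
    (pos θ.f00 + pos θ.f11 + pos θ.f22 + pos θ.f01 + pos θ.f02 + pos θ.f12) / 100 ≤ 0
  carve_init : θ.gc + (pos θ.g0 + pos θ.g1 + pos θ.g2) / 10 +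
    (pos θ.g00 + pos θ.g11 + pos θ.g22 + pos θ.g01 + pos θ.g02 + pos θ.g12) / 100 ≤ 0

end Params

/-! ## The faces -/

variable (θ : Params)

/-- Cubic floor `x_j ≥ κ x_i³ − ε` as a face. [folklore] -/
def cubFaceP (κ ε : ℚ) (i j : Fin 4) (x : Fin 4 → ℝ) : ℝ := (κ : ℝ) * x i ^ 3 - (ε : ℝ) - x j

/-- Its gradient. [folklore] -/
def cubGradP (κ : ℚ) (i j : Fin 4) (m : Fin 4) (x : Fin 4 → ℝ) : ℝ :=
  (if m = i then 3 * (κ : ℝ) * x i ^ 2 else 0) + (if m = j then -1 else 0)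

/-- The gradient sum of a cubic floor. [folklore] -/
theorem sum_cubGradP (κ : ℚ) (i j : Fin 4) (a : Fin 4 → ℝ) (x : Fin 4 → ℝ) :
    ∑ m, cubGradP κ i j m x * a m = 3 * (κ : ℝ) * x i ^ 2 * a i - a j := by
  simp only [cubGradP, add_mul, Finset.sum_add_distrib, ite_mul, zero_mul, Finset.sum_ite_eq', Finset.mem_univ, if_true]
  ring

/-- A cubic floor is continuous. [folklore] -/
theorem cubFaceP_continuous (κ ε : ℚ) (i j : Fin 4) : Continuous (cubFaceP κ ε i j) := by
  unfold cubFaceP; fun_prop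

/-- The right-sided chain rule for a cubic floor. [folklore] -/
theorem cubFaceP_hasDerivWithinAt (κ ε : ℚ) (i j : Fin 4) (X : ℝ → Fin 4 → ℝ) (X' : Fin 4 → ℝ) (S : Set ℝ) (t : ℝ)
    (hX : ∀ m, HasDerivWithinAt (fun r => X r m) (X' m) S t) :
    HasDerivWithinAt (fun r => cubFaceP κ ε i j (X r)) (∑ m, cubGradP κ i j m (X t) * X' m) S t := by
  rw [sum_cubGradP]
  have h := ((((hX i).pow 3).const_mul (κ : ℝ)).sub (hasDerivWithinAt_const t S (ε : ℝ))).sub (hX j)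
  refine (h.congr_of_eventuallyEq (Filter.Eventually.of_forall fun r => by simp [cubFaceP]) (by simp [cubFaceP])).congr_deriv ?_
  push_cast; ring

/-- Quadric floor: quadratic part. [folklore] -/
def floorQ (q00 q11 q22 q01 q02 q12 : ℚ) : Fin 4 → Fin 4 → ℝ :=
  ![![(q00 : ℝ), q01, q02, 0], ![0, q11, q12, 0], ![0, 0, q22, 0], ![0, 0, 0, 0]]
/-- Quadric floor: linear part. [folklore] -/
def floorL (l0 l1 l2 : ℚ) : Fin 4 → ℝ := ![(l0 : ℝ), l1, l2, -1]
/-- Cap on `x_i`: linear part. [folklore] -/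
def capL (i : Fin 4) : Fin 4 → ℝ := fun j => if j = i then 1 else 0
/-- Corner cap A: linear part. [folklore] -/
def capAL : Fin 4 → ℝ := ![(θ.a0 : ℝ), θ.a1, θ.a2, 0]
/-- Corner cap B: linear part. [folklore] -/
def capBL : Fin 4 → ℝ := ![(1 : ℝ), θ.b1, 0, 0]

/-- The ten faces of the design `θ` (`face θ k x ≤ 0` cuts out `Ω`). [folklore] -/
def face : Ix → (Fin 4 → ℝ) → ℝ
  | .cap1 => quadFace 0 (capL 1) (-(49 / 50))
  | .cap2 => quadFace 0 (capL 2) (-(49 / 50))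
  | .cap3 => quadFace 0 (capL 3) (-(49 / 50))
  | .cub0 => cubFaceP θ.kap θ.eps 0 1
  | .cub1 => cubFaceP θ.kap θ.eps 1 2
  | .cub2 => cubFaceP θ.kap θ.eps 2 3
  | .capA => quadFace 0 (capAL θ) (-(θ.ac : ℝ))
  | .capB => quadFace 0 (capBL θ) (-(θ.bc : ℝ))
  | .bulk => quadFace (floorQ θ.f00 θ.f11 θ.f22 θ.f01 θ.f02 θ.f12) (floorL θ.f0 θ.f1 θ.f2) (θ.fc : ℝ)
  | .carve => quadFace (floorQ θ.g00 θ.g11 θ.g22 θ.g01 θ.g02 θ.g12) (floorL θ.g0 θ.g1 θ.g2) (θ.gc : ℝ)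

/-- Their partial derivatives. [folklore] -/
def faceGrad : Ix → Fin 4 → (Fin 4 → ℝ) → ℝ
  | .cap1 => quadFaceGrad 0 (capL 1)
  | .cap2 => quadFaceGrad 0 (capL 2)
  | .cap3 => quadFaceGrad 0 (capL 3)
  | .cub0 => cubGradP θ.kap 0 1
  | .cub1 => cubGradP θ.kap 1 2
  | .cub2 => cubGradP θ.kap 2 3
  | .capA => quadFaceGrad 0 (capAL θ)
  | .capB => quadFaceGrad 0 (capBL θ)
  | .bulk => quadFaceGrad (floorQ θ.f00 θ.f11 θ.f22 θ.f01 θ.f02 θ.f12) (floorL θ.f0 θ.f1 θ.f2)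
  | .carve => quadFaceGrad (floorQ θ.g00 θ.g11 θ.g22 θ.g01 θ.g02 θ.g12) (floorL θ.g0 θ.g1 θ.g2)

/-- Continuity of every face (`hcontg`). [folklore] -/
theorem face_continuous : ∀ k, Continuous (face θ k) := by
  intro k; cases k
  all_goals first | exact quadFace_continuous _ _ _ | exact cubFaceP_continuous _ _ _ _

/-- Right-sided chain rule of every face (`hchain`). [folklore] -/
theorem face_hasDerivWithinAt : ∀ k (X : ℝ → Fin 4 → ℝ) (X' : Fin 4 → ℝ) (S : Set ℝ) (t : ℝ),
    (∀ i, HasDerivWithinAt (fun r => X r i) (X' i) S t) →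
    HasDerivWithinAt (fun r => face θ k (X r)) (∑ i, faceGrad θ k i (X t) * X' i) S t := by
  intro k X X' S t hX; cases k
  all_goals first | exact quadFace_hasDerivWithinAt _ _ _ X X' S t hX | exact cubFaceP_hasDerivWithinAt _ _ _ _ X X' S t hX

/-- The faces written out as polynomials. [folklore] -/
theorem face_eq (x : Fin 4 → ℝ) :
    face θ .cap1 x = x 1 - 49 / 50 ∧ face θ .cap2 x = x 2 - 49 / 50 ∧ face θ .cap3 x = x 3 - 49 / 50 ∧
    face θ .cub0 x = (θ.kap : ℝ) * x 0 ^ 3 - (θ.eps : ℝ) - x 1 ∧ face θ .cub1 x = (θ.kap : ℝ) * x 1 ^ 3 - (θ.eps : ℝ) - x 2 ∧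
    face θ .cub2 x = (θ.kap : ℝ) * x 2 ^ 3 - (θ.eps : ℝ) - x 3 ∧
    face θ .capA x = (θ.a0 : ℝ) * x 0 + (θ.a1 : ℝ) * x 1 + (θ.a2 : ℝ) * x 2 - (θ.ac : ℝ) ∧
    face θ .capB x = x 0 + (θ.b1 : ℝ) * x 1 - (θ.bc : ℝ) ∧
    face θ .bulk x = (θ.fc : ℝ) + (θ.f0 : ℝ) * x 0 + (θ.f1 : ℝ) * x 1 + (θ.f2 : ℝ) * x 2 + (θ.f00 : ℝ) * (x 0 * x 0) +
      (θ.f11 : ℝ) * (x 1 * x 1) + (θ.f22 : ℝ) * (x 2 * x 2) + (θ.f01 : ℝ) * (x 0 * x 1) + (θ.f02 : ℝ) * (x 0 * x 2) +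
      (θ.f12 : ℝ) * (x 1 * x 2) - x 3 ∧
    face θ .carve x = (θ.gc : ℝ) + (θ.g0 : ℝ) * x 0 + (θ.g1 : ℝ) * x 1 + (θ.g2 : ℝ) * x 2 + (θ.g00 : ℝ) * (x 0 * x 0) +
      (θ.g11 : ℝ) * (x 1 * x 1) + (θ.g22 : ℝ) * (x 2 * x 2) + (θ.g01 : ℝ) * (x 0 * x 1) + (θ.g02 : ℝ) * (x 0 * x 2) +
      (θ.g12 : ℝ) * (x 1 * x 2) - x 3 := by
  refine ⟨?_, ?_, ?_, ?_, ?_, ?_, ?_, ?_, ?_, ?_⟩ <;>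
    simp [face, quadFace, cubFaceP, capL, capAL, capBL, floorQ, floorL, Fin.sum_univ_four] <;> ring

/-- The gradients written out. [folklore] -/
theorem faceGrad_eq (x : Fin 4 → ℝ) :
    (faceGrad θ .cap1 0 x = 0 ∧ faceGrad θ .cap1 1 x = 1 ∧ faceGrad θ .cap1 2 x = 0 ∧ faceGrad θ .cap1 3 x = 0) ∧
    (faceGrad θ .cap2 0 x = 0 ∧ faceGrad θ .cap2 1 x = 0 ∧ faceGrad θ .cap2 2 x = 1 ∧ faceGrad θ .cap2 3 x = 0) ∧
    (faceGrad θ .cap3 0 x = 0 ∧ faceGrad θ .cap3 1 x = 0 ∧ faceGrad θ .cap3 2 x = 0 ∧ faceGrad θ .cap3 3 x = 1) ∧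
    (faceGrad θ .cub0 0 x = 3 * (θ.kap : ℝ) * x 0 ^ 2 ∧ faceGrad θ .cub0 1 x = -1 ∧ faceGrad θ .cub0 2 x = 0 ∧ faceGrad θ .cub0 3 x = 0) ∧
    (faceGrad θ .cub1 0 x = 0 ∧ faceGrad θ .cub1 1 x = 3 * (θ.kap : ℝ) * x 1 ^ 2 ∧ faceGrad θ .cub1 2 x = -1 ∧ faceGrad θ .cub1 3 x = 0) ∧
    (faceGrad θ .cub2 0 x = 0 ∧ faceGrad θ .cub2 1 x = 0 ∧ faceGrad θ .cub2 2 x = 3 * (θ.kap : ℝ) * x 2 ^ 2 ∧ faceGrad θ .cub2 3 x = -1) ∧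
    (faceGrad θ .capA 0 x = (θ.a0 : ℝ) ∧ faceGrad θ .capA 1 x = (θ.a1 : ℝ) ∧ faceGrad θ .capA 2 x = (θ.a2 : ℝ) ∧ faceGrad θ .capA 3 x = 0) ∧
    (faceGrad θ .capB 0 x = 1 ∧ faceGrad θ .capB 1 x = (θ.b1 : ℝ) ∧ faceGrad θ .capB 2 x = 0 ∧ faceGrad θ .capB 3 x = 0) ∧
    (faceGrad θ .bulk 0 x = (θ.f0 : ℝ) + 2 * (θ.f00 : ℝ) * x 0 + (θ.f01 : ℝ) * x 1 + (θ.f02 : ℝ) * x 2 ∧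
      faceGrad θ .bulk 1 x = (θ.f1 : ℝ) + (θ.f01 : ℝ) * x 0 + 2 * (θ.f11 : ℝ) * x 1 + (θ.f12 : ℝ) * x 2 ∧
      faceGrad θ .bulk 2 x = (θ.f2 : ℝ) + (θ.f02 : ℝ) * x 0 + (θ.f12 : ℝ) * x 1 + 2 * (θ.f22 : ℝ) * x 2 ∧ faceGrad θ .bulk 3 x = -1) ∧
    (faceGrad θ .carve 0 x = (θ.g0 : ℝ) + 2 * (θ.g00 : ℝ) * x 0 + (θ.g01 : ℝ) * x 1 + (θ.g02 : ℝ) * x 2 ∧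
      faceGrad θ .carve 1 x = (θ.g1 : ℝ) + (θ.g01 : ℝ) * x 0 + 2 * (θ.g11 : ℝ) * x 1 + (θ.g12 : ℝ) * x 2 ∧
      faceGrad θ .carve 2 x = (θ.g2 : ℝ) + (θ.g02 : ℝ) * x 0 + (θ.g12 : ℝ) * x 1 + 2 * (θ.g22 : ℝ) * x 2 ∧ faceGrad θ .carve 3 x = -1) := by
  refine ⟨⟨?_, ?_, ?_, ?_⟩, ⟨?_, ?_, ?_, ?_⟩, ⟨?_, ?_, ?_, ?_⟩, ⟨?_, ?_, ?_, ?_⟩, ⟨?_, ?_, ?_, ?_⟩, ⟨?_, ?_, ?_, ?_⟩,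
    ⟨?_, ?_, ?_, ?_⟩, ⟨?_, ?_, ?_, ?_⟩, ⟨?_, ?_, ?_, ?_⟩, ⟨?_, ?_, ?_, ?_⟩⟩ <;>
    simp [faceGrad, quadFaceGrad, cubGradP, capL, capAL, capBL, floorQ, floorL, Fin.sum_univ_four] <;> ring

/-! ## Region facts under admissibility -/

/-- `q · m ≤ pos q · M` for a monomial `0 ≤ m ≤ M`. [folklore] -/
theorem mul_le_pos_mul {q : ℚ} {m M : ℝ} (h0 : 0 ≤ m) (hM : m ≤ M) : (q : ℝ) * m ≤ (Params.pos q : ℝ) * M := by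
  have hp : (q : ℝ) ≤ (Params.pos q : ℝ) := by unfold Params.pos; exact_mod_cast le_max_left q 0
  have hp0 : (0 : ℝ) ≤ (Params.pos q : ℝ) := by unfold Params.pos; exact_mod_cast le_max_right q 0
  calc (q : ℝ) * m ≤ (Params.pos q : ℝ) * m := mul_le_mul_of_nonneg_right hp h0
    _ ≤ (Params.pos q : ℝ) * M := mul_le_mul_of_nonneg_left hM hp0

set_option maxHeartbeats 400000 in
/-- `[0, 1/10]⁴ ⊂ Ω` (`hInit` with `δ₀ = 1/10`) for an admissible design. [folklore] -/
theorem face_init (hθ : θ.Adm) (x : Fin 4 → ℝ) (h0 : ∀ i, 0 ≤ x i) (h1 : ∀ i, x i ≤ (1 / 10 : ℝ)) : ∀ k, face θ k x ≤ 0 := by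
  obtain ⟨e1, e2, e3, e4, e5, e6, e7, e8, e9, e10⟩ := face_eq θ x
  have a0 := h0 0; have a1 := h0 1; have a2 := h0 2; have a3 := h0 3
  have b0 := h1 0; have b1 := h1 1; have b2 := h1 2; have b3 := h1 3
  have p0 := pow_le_pow_left₀ a0 b0 3; have p1 := pow_le_pow_left₀ a1 b1 3; have p2 := pow_le_pow_left₀ a2 b2 3
  norm_num at p0 p1 p2
  have hk : (0 : ℝ) ≤ θ.kap := by exact_mod_cast hθ.kap_nn
  have hci : (θ.kap : ℝ) / 1000 ≤ θ.eps := by exact_mod_cast hθ.cub_init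
  have mA : ∀ {u : ℝ}, 0 ≤ u → u ≤ 1 / 10 → ∀ {w : ℝ}, 0 ≤ w → w ≤ 1 / 10 → 0 ≤ u * w ∧ u * w ≤ 1 / 100 := by
    intro u hu hu' w hw hw'
    exact ⟨mul_nonneg hu hw, by nlinarith⟩
  intro k; cases k
  · rw [e1]; linarith
  · rw [e2]; linarith
  · rw [e3]; linarith
  · rw [e4]; linarith [mul_le_mul_of_nonneg_left p0 hk]
  · rw [e5]; linarith [mul_le_mul_of_nonneg_left p1 hk]
  · rw [e6]; linarith [mul_le_mul_of_nonneg_left p2 hk]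
  · rw [e7]
    have ha0 : (0:ℝ) ≤ θ.a0 := by exact_mod_cast hθ.a0_pos.le
    have ha1 : (0:ℝ) ≤ θ.a1 := by exact_mod_cast hθ.a1_nn
    have ha2 : (0:ℝ) ≤ θ.a2 := by exact_mod_cast hθ.a2_nn
    have hc : ((θ.a0 : ℝ) + θ.a1 + θ.a2) / 10 ≤ θ.ac := by exact_mod_cast hθ.capA_init
    linarith [mul_le_mul_of_nonneg_left b0 ha0, mul_le_mul_of_nonneg_left b1 ha1, mul_le_mul_of_nonneg_left b2 ha2]
  · rw [e8]
    have hb1 : (0:ℝ) ≤ θ.b1 := by exact_mod_cast hθ.b1_nn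
    have hc : ((1 : ℝ) + θ.b1) / 10 ≤ θ.bc := by exact_mod_cast hθ.capB_init
    linarith [mul_le_mul_of_nonneg_left b1 hb1]
  · rw [e9]
    have hc := hθ.bulk_init
    have hc' : (θ.fc : ℝ) + ((Params.pos θ.f0 : ℝ) + Params.pos θ.f1 + Params.pos θ.f2) / 10 +
        ((Params.pos θ.f00 : ℝ) + Params.pos θ.f11 + Params.pos θ.f22 + Params.pos θ.f01 + Params.pos θ.f02 + Params.pos θ.f12) / 100
        ≤ 0 := by exact_mod_cast hc
    have t0 := mul_le_pos_mul (q := θ.f0) a0 b0; have t1 := mul_le_pos_mul (q := θ.f1) a1 b1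
    have t2 := mul_le_pos_mul (q := θ.f2) a2 b2
    have t00 := mul_le_pos_mul (q := θ.f00) (mA a0 b0 a0 b0).1 (mA a0 b0 a0 b0).2
    have t11 := mul_le_pos_mul (q := θ.f11) (mA a1 b1 a1 b1).1 (mA a1 b1 a1 b1).2
    have t22 := mul_le_pos_mul (q := θ.f22) (mA a2 b2 a2 b2).1 (mA a2 b2 a2 b2).2
    have t01 := mul_le_pos_mul (q := θ.f01) (mA a0 b0 a1 b1).1 (mA a0 b0 a1 b1).2
    have t02 := mul_le_pos_mul (q := θ.f02) (mA a0 b0 a2 b2).1 (mA a0 b0 a2 b2).2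
    have t12 := mul_le_pos_mul (q := θ.f12) (mA a1 b1 a2 b2).1 (mA a1 b1 a2 b2).2
    linarith
  · rw [e10]
    have hc := hθ.carve_init
    have hc' : (θ.gc : ℝ) + ((Params.pos θ.g0 : ℝ) + Params.pos θ.g1 + Params.pos θ.g2) / 10 +
        ((Params.pos θ.g00 : ℝ) + Params.pos θ.g11 + Params.pos θ.g22 + Params.pos θ.g01 + Params.pos θ.g02 + Params.pos θ.g12) / 100
        ≤ 0 := by exact_mod_cast hc
    have t0 := mul_le_pos_mul (q := θ.g0) a0 b0; have t1 := mul_le_pos_mul (q := θ.g1) a1 b1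
    have t2 := mul_le_pos_mul (q := θ.g2) a2 b2
    have t00 := mul_le_pos_mul (q := θ.g00) (mA a0 b0 a0 b0).1 (mA a0 b0 a0 b0).2
    have t11 := mul_le_pos_mul (q := θ.g11) (mA a1 b1 a1 b1).1 (mA a1 b1 a1 b1).2
    have t22 := mul_le_pos_mul (q := θ.g22) (mA a2 b2 a2 b2).1 (mA a2 b2 a2 b2).2
    have t01 := mul_le_pos_mul (q := θ.g01) (mA a0 b0 a1 b1).1 (mA a0 b0 a1 b1).2
    have t02 := mul_le_pos_mul (q := θ.g02) (mA a0 b0 a2 b2).1 (mA a0 b0 a2 b2).2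
    have t12 := mul_le_pos_mul (q := θ.g12) (mA a1 b1 a2 b2).1 (mA a1 b1 a2 b2).2
    linarith

/-- `Ω ⊂ {x₃ ≤ 49/50}` (`hSafe`). [folklore] -/
theorem face_safe (x : Fin 4 → ℝ) (_h0 : ∀ i, 0 ≤ x i) (h : ∀ k, face θ k x ≤ 0) : x 3 ≤ (49 / 50 : ℝ) := by
  have := h .cap3
  rw [(face_eq θ x).2.2.1] at this
  linarith

/-- The structural DAMPING sign conditions (caps, corner caps, cubic floors on the active face with `b2 ≤ 3`). [folklore] -/
theorem face_damping_easy (hθ : θ.Adm) (x : Fin 4 → ℝ) (b2 : ℝ) (h0 : ∀ i, 0 ≤ x i) (hb2 : 0 ≤ b2) (hb3 : b2 ≤ 3) :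
    ∀ k, k ≠ .bulk → k ≠ .carve → face θ k x = 0 →
      0 ≤ faceGrad θ k 0 x * x 0 + faceGrad θ k 1 x * (b2 * x 1) + faceGrad θ k 2 x * (b2 ^ 2 * x 2) +
        faceGrad θ k 3 x * (b2 ^ 3 * x 3) := by
  obtain ⟨g1, g2, g3, g4, g5, g6, g7, g8, -, -⟩ := faceGrad_eq θ x
  obtain ⟨-, -, -, e4, e5, e6, -, -, -, -⟩ := face_eq θ x
  have a0 := h0 0; have a1 := h0 1; have a2 := h0 2; have a3 := h0 3
  have hk : (0 : ℝ) ≤ θ.kap := by exact_mod_cast hθ.kap_nn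
  have he : (0 : ℝ) ≤ θ.eps := by exact_mod_cast hθ.eps_nn
  have ha0 : (0:ℝ) ≤ θ.a0 := by exact_mod_cast hθ.a0_pos.le
  have ha1 : (0:ℝ) ≤ θ.a1 := by exact_mod_cast hθ.a1_nn
  have ha2 : (0:ℝ) ≤ θ.a2 := by exact_mod_cast hθ.a2_nn
  have hb1 : (0:ℝ) ≤ θ.b1 := by exact_mod_cast hθ.b1_nn
  intro k hkb hkc hk0; cases k
  · rw [g1.1, g1.2.1, g1.2.2.1, g1.2.2.2]; positivity
  · rw [g2.1, g2.2.1, g2.2.2.1, g2.2.2.2]; positivity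
  · rw [g3.1, g3.2.1, g3.2.2.1, g3.2.2.2]; positivity
  · rw [g4.1, g4.2.1, g4.2.2.1, g4.2.2.2]
    rw [e4] at hk0
    have hx1 : x 1 = (θ.kap : ℝ) * x 0 ^ 3 - θ.eps := by linarith
    rw [hx1]
    have h3 : 0 ≤ (θ.kap : ℝ) * (x 0 ^ 3 * (3 - b2)) := mul_nonneg hk (mul_nonneg (pow_nonneg a0 3) (by linarith))
    have h4 : 0 ≤ b2 * (θ.eps : ℝ) := mul_nonneg hb2 he
    linarith [h3, h4]
  · rw [g5.1, g5.2.1, g5.2.2.1, g5.2.2.2]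
    rw [e5] at hk0
    have hx2 : x 2 = (θ.kap : ℝ) * x 1 ^ 3 - θ.eps := by linarith
    rw [hx2]
    have h3 : 0 ≤ b2 * ((θ.kap : ℝ) * (x 1 ^ 3 * (3 - b2))) := mul_nonneg hb2 (mul_nonneg hk (mul_nonneg (pow_nonneg a1 3) (by linarith)))
    have h4 : 0 ≤ b2 * b2 * (θ.eps : ℝ) := mul_nonneg (mul_nonneg hb2 hb2) he
    linarith [h3, h4]
  · rw [g6.1, g6.2.1, g6.2.2.1, g6.2.2.2]
    rw [e6] at hk0
    have hx3 : x 3 = (θ.kap : ℝ) * x 2 ^ 3 - θ.eps := by linarith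
    rw [hx3]
    have h3 : 0 ≤ b2 * b2 * ((θ.kap : ℝ) * (x 2 ^ 3 * (3 - b2))) :=
      mul_nonneg (mul_nonneg hb2 hb2) (mul_nonneg hk (mul_nonneg (pow_nonneg a2 3) (by linarith)))
    have h4 : 0 ≤ b2 * b2 * b2 * (θ.eps : ℝ) := mul_nonneg (mul_nonneg (mul_nonneg hb2 hb2) hb2) he
    linarith [h3, h4]
  · rw [g7.1, g7.2.1, g7.2.2.1, g7.2.2.2]; positivity
  · rw [g8.1, g8.2.1, g8.2.2.1, g8.2.2.2]; positivity
  · exact absurd rfl hkb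
  · exact absurd rfl hkc

end Summit.NavierStokesRegularity.NavierStokesRegularity.Theorems.VirtualFloor.GapFamily

end
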